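import Summits.QuantumFields.QCD.Theses.GapBuysCauchyRate
import Summits.QuantumFields.QCD.Theses.FourMirrorsWardE1
import Summits.QuantumFields.QCD.Theses.DiagonalSpine
import Summits.QuantumFields.QCD.Theorems.GapBuysCauchyRateRotationRestorationDefs
import Summits.QuantumFields.QCD.Theorems.GapBuysCauchyRateRotationRestorationLatticePermCovariance
import Summits.QuantumFields.QCD.Theorems.GapBuysCauchyRateRotationRestorationLatticeInvariancePassesToLimit
import Summits.QuantumFields.QCD.Theorems.GapBuysCauchyRateRotationRestorationEvenPermSpinor
import Summits.QuantumFields.QCD.Theorems.GapBuysCauchyRateRotationRestorationSeparatedTensorsTotal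
import Literature.MathematicalPhysics.QuantumFieldTheory.SchwingerLimitInheritance
import HarnessLib

/-!
# `RotationRestoration` reduced to planar Ward restoration on separated tensors

Crux `RotationRestoration` (item stmt-QuantumFields-8840; decl
`Summit.QuantumFields.QCD.Theses.GapBuysCauchyRate.RotationRestoration`, shared verbatim — and definitionally —
with `FourMirrorsWardE1.RotationRestoration` (primary) and `DiagonalSpine.RotationRestoration`), line
`registered` (skeleton `Cruxes/RotationRestoration/Lines/birth.lean`, reshape r1 by the line lead).

This file is the SORRY-FREE COMPOSITION of the skeleton with five of its six registered stubs discharged by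
landed theorems: `stub_latticePermCovariance` (S1a, p149351), `stub_latticeInvariancePassesToLimit` (S1b,
p150397), `stub_evenPermSpinor` (S1c, p151311), `stub_separatedTensorsTotal` (S3, p151153),
`stub_so4FromCoordinatePlanes` (S4, p147247).  What remains is the ONE physics hypothesis
`PlanarWardOnSeparatedTensors` (S2, registered stub `stub_planarWardOnSeparatedTensors`, statement in
`GapBuysCauchyRateRotationRestorationDefs`): under the crux's own hypotheses every tied Schwinger family is
invariant, on separated real tensors, under the determinant-one isometries of `ℝ⁴` fixing `e₂, e₃`.

* `RotationRestoration_of_planarWard : PlanarWardOnSeparatedTensors → RotationRestoration` (the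
  `GapBuysCauchyRate` copy), `…_primary` (`FourMirrorsWardE1`), `…_diagonalSpine` — CONDITIONAL results: the
  crux is now EQUIVALENT to S2 (the converse implication is trivial: planar isometries have determinant one
  and separated tensors are off-diagonal, `LatticeInvariancePassesToLimit.isOffDiagonal_of_isSeparated`).

Proof: exact covariance under EVEN axis permutations (S1a with the intertwiners of S1c, passed to every tied
limit by S1b) is lifted from separated tensors to `⁰𝒮` by totality (S3); the determinant-one isometries
leaving every `S n σ` invariant on `⁰𝒮` form a group containing the coordinate `SO(2)₀₁` (S2 lifted by S3)
and, by conjugation with the even permutations `(0 1 2)` and `(0 2)(1 3)`, the `SO(2)`'s of the planes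
`(1,2)` and `(2,3)`; Givens generation (S4) gives all of `SO(4)`.  Evenness is essential (odd permutations
flip the pseudoscalar species, and the additive counterterms then spoil covariance).
-/

noncomputable section

namespace Summit.QuantumFields.QCD.Cruxes.RotationRestoration.Birth

open scoped BigOperators Topology SchwartzMap
open Filter
open Literature.MathematicalPhysics.QuantumLattice Literature.MathematicalPhysics.AQFT
  Literature.MathematicalPhysics.QuantumFieldTheory
open Summit.QuantumFields.QCD.Theses.GapBuysCauchyRate (RotationRestoration)

/-! ## Composition -/

section Action

variable {E : Type*} [NormedAddCommGroup E] [NormedSpace ℝ E] {n : ℕ}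

/-- **Inversion.**  If the isometry `Q` leaves every `S m τ` invariant on `⁰𝒮`, so does `Q⁻¹`
(`linActMulti` is an action — `linActMulti (A.trans B) = linActMulti B ∘ linActMulti A` and
`linActMulti refl = id` hold by `rfl` — and `⁰𝒮` is stable under it,
`LatticeInvariancePassesToLimit.isOffDiagonal_linActMulti`). [folklore] -/
theorem invariant_symm {ι : Type*} (S : LabelledSchwingerFamily ι E) (Q : E ≃ₗᵢ[ℝ] E)
    (hQ : ∀ (m : ℕ) (τ : Fin m → ι) (G : 𝓢((Fin m → E), ℂ)), IsOffDiagonal G →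
      S m τ (linActMulti Q G) = S m τ G)
    (m : ℕ) (τ : Fin m → ι) (G : 𝓢((Fin m → E), ℂ)) (hG : IsOffDiagonal G) :
    S m τ (linActMulti Q.symm G) = S m τ G := by
  have h := hQ m τ _ (LatticeInvariancePassesToLimit.isOffDiagonal_linActMulti Q.symm hG)
  have hid : linActMulti Q (linActMulti Q.symm G) = G := by
    ext x
    simp only [linActMulti_apply]
    congr 1
    funext i
    exact Q.symm.symm_apply_apply (x i)
  rw [hid] at h
  exact h.symm

/-- **Transport by conjugation.**  If the isometry `Q` leaves every `S m τ` invariant on `⁰𝒮`, and so does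
`C = (x ↦ Q⁻¹ (A (Q x)))`, then so does `A = Q C Q⁻¹`. [folklore] -/
theorem invariant_of_conj {ι : Type*} (S : LabelledSchwingerFamily ι E) (Q A : E ≃ₗᵢ[ℝ] E)
    (hQ : ∀ (m : ℕ) (τ : Fin m → ι) (G : 𝓢((Fin m → E), ℂ)), IsOffDiagonal G →
      S m τ (linActMulti Q G) = S m τ G)
    (hC : ∀ (m : ℕ) (τ : Fin m → ι) (G : 𝓢((Fin m → E), ℂ)), IsOffDiagonal G →
      S m τ (linActMulti (Q.trans (A.trans Q.symm)) G) = S m τ G)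
    (m : ℕ) (τ : Fin m → ι) (G : 𝓢((Fin m → E), ℂ)) (hG : IsOffDiagonal G) :
    S m τ (linActMulti A G) = S m τ G := by
  -- `A · G = Q · (C · (Q⁻¹ · G))` with `C = Q⁻¹ A Q`
  have hA : linActMulti A G =
      linActMulti Q (linActMulti (Q.trans (A.trans Q.symm)) (linActMulti Q.symm G)) := by
    ext x
    simp only [linActMulti_apply, LinearIsometryEquiv.symm_trans, LinearIsometryEquiv.trans_apply,
      LinearIsometryEquiv.symm_symm, LinearIsometryEquiv.apply_symm_apply]
  rw [hA, hQ m τ _ (LatticeInvariancePassesToLimit.isOffDiagonal_linActMulti _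
      (LatticeInvariancePassesToLimit.isOffDiagonal_linActMulti _ hG)),
    hC m τ _ (LatticeInvariancePassesToLimit.isOffDiagonal_linActMulti _ hG), invariant_symm S Q hQ m τ G hG]

end Action

open Summit.QuantumFields.YangMills.Theorems.PlanarToEuclidean (det_trans det_symm)

/-- The determinant of a conjugate `x ↦ Q⁻¹ (A (Q x))` of a determinant-one isometry is one. [folklore] -/
theorem det_conj (Q A : EuclideanSpace ℝ (Fin 4) ≃ₗᵢ[ℝ] EuclideanSpace ℝ (Fin 4)) (hA : LinearMap.det (A.toLinearEquiv : EuclideanSpace ℝ (Fin 4) →ₗ[ℝ] EuclideanSpace ℝ (Fin 4)) = 1) :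
    LinearMap.det ((Q.trans (A.trans Q.symm)).toLinearEquiv : EuclideanSpace ℝ (Fin 4) →ₗ[ℝ] EuclideanSpace ℝ (Fin 4)) = 1 := by
  have h1 : LinearMap.det ((Q.trans Q.symm).toLinearEquiv : EuclideanSpace ℝ (Fin 4) →ₗ[ℝ] EuclideanSpace ℝ (Fin 4)) = 1 := by
    rw [LinearIsometryEquiv.self_trans_symm]
    exact LinearMap.det_id
  rw [det_trans] at h1
  rw [det_trans, det_trans, hA, one_mul, h1]

/-! The two conjugators are the EVEN permutations `πA = (0 2)(0 1)` (the 3-cycle `0 ↦ 1 ↦ 2 ↦ 0`,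
`3 ↦ 3`) and `πB = (0 2)(1 3)`, written as explicit products of transpositions. -/

/-- `πA = (0 2)(0 1)` is even. [folklore] -/
theorem sign_permA : Equiv.Perm.sign (Equiv.swap (0 : Fin 4) 2 * Equiv.swap 0 1 : Equiv.Perm (Fin 4)) = 1 := by decide
/-- `πB = (0 2)(1 3)` is even. [folklore] -/
theorem sign_permB : Equiv.Perm.sign (Equiv.swap (0 : Fin 4) 2 * Equiv.swap 1 3 : Equiv.Perm (Fin 4)) = 1 := by decide
/-- `πA 2 = 0`. [folklore] -/
theorem permA_two : (Equiv.swap (0 : Fin 4) 2 * Equiv.swap 0 1 : Equiv.Perm (Fin 4)) 2 = 0 := by decide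
/-- `πA 3 = 3`. [folklore] -/
theorem permA_three : (Equiv.swap (0 : Fin 4) 2 * Equiv.swap 0 1 : Equiv.Perm (Fin 4)) 3 = 3 := by decide
/-- `πA⁻¹ 0 = 2`. [folklore] -/
theorem permA_symm_zero : (Equiv.swap (0 : Fin 4) 2 * Equiv.swap 0 1 : Equiv.Perm (Fin 4)).symm 0 = 2 := by decide
/-- `πA⁻¹ 3 = 3`. [folklore] -/
theorem permA_symm_three : (Equiv.swap (0 : Fin 4) 2 * Equiv.swap 0 1 : Equiv.Perm (Fin 4)).symm 3 = 3 := by decide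
/-- `πB 2 = 0`. [folklore] -/
theorem permB_two : (Equiv.swap (0 : Fin 4) 2 * Equiv.swap 1 3 : Equiv.Perm (Fin 4)) 2 = 0 := by decide
/-- `πB 3 = 1`. [folklore] -/
theorem permB_three : (Equiv.swap (0 : Fin 4) 2 * Equiv.swap 1 3 : Equiv.Perm (Fin 4)) 3 = 1 := by decide
/-- `πB⁻¹ 0 = 2`. [folklore] -/
theorem permB_symm_zero : (Equiv.swap (0 : Fin 4) 2 * Equiv.swap 1 3 : Equiv.Perm (Fin 4)).symm 0 = 2 := by decide
/-- `πB⁻¹ 1 = 3`. [folklore] -/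
theorem permB_symm_one : (Equiv.swap (0 : Fin 4) 2 * Equiv.swap 1 3 : Equiv.Perm (Fin 4)).symm 1 = 3 := by decide

/-- `axisPerm π eᵢ = e_{π i}`. [folklore] -/
theorem axisPerm_single (π : Equiv.Perm (Fin 4)) (i : Fin 4) :
    axisPerm π (EuclideanSpace.single i 1) = EuclideanSpace.single (π i) 1 :=
  LinearIsometryEquiv.piLpCongrLeft_single _ _ _

/-- `(axisPerm π)⁻¹ eᵢ = e_{π⁻¹ i}`. [folklore] -/
theorem axisPerm_symm_single (π : Equiv.Perm (Fin 4)) (i : Fin 4) :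
    (axisPerm π).symm (EuclideanSpace.single i 1) = EuclideanSpace.single (π.symm i) 1 := by
  rw [axisPerm, LinearIsometryEquiv.piLpCongrLeft_symm]
  exact LinearIsometryEquiv.piLpCongrLeft_single _ _ _

/-- **The crux from the six stub statements** (concludes `RotationRestoration` BY NAME).  Exact even-permutation
covariance (S1a with the intertwiners of S1c, passed to the limit by S1b) is lifted to `⁰𝒮` by totality
(S3); the determinant-one isometries leaving every `S n σ` invariant on `⁰𝒮` form a group containing the
coordinate `SO(2)₀₁` (S2 lifted by S3) and — by conjugation with the axis permutations `(0 1 2)`,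
`(0 2)(1 3)` — the `SO(2)`'s of the planes `(1,2)` and `(2,3)`; S4 concludes. -/
theorem RotationRestoration_of (hCov : LatticePermCovariance) (hLim : LatticeInvariancePassesToLimit)
    (hSpin : EvenPermSpinor) (hP : PlanarWardOnSeparatedTensors) (hT : SeparatedTensorsTotal)
    (hGen : SO4FromCoordinatePlanes) :
    RotationRestoration := by
  intro Nf sch hAF hbr hgap S hconv n σ Rot hdet F hF
  have hlim : IsLatticeLimit sch S := hconv
  -- (1) exact invariance under even axis permutations, on all of `⁰𝒮`
  have hperm : ∀ π : Equiv.Perm (Fin 4), Equiv.Perm.sign π = 1 →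
      ∀ (m : ℕ) (τ : Fin m → QCDField Nf) (G : 𝓢((Fin m → EuclideanSpace ℝ (Fin 4)), ℂ)), IsOffDiagonal G →
        S m τ (linActMulti (axisPerm π) G) = S m τ G := by
    intro π hπ m τ
    obtain ⟨Sm, Sm', hI, h5⟩ := hSpin π hπ
    exact hT m ((S m τ).comp (linActMulti (axisPerm π))) (S m τ)
      (fun f hf G hG => hLim Nf sch S hlim (axisPerm π)
        (fun k n' σ' f' => hCov Nf sch k π Sm Sm' hI h5 n' σ' f') m τ f hf G hG)
  -- (2) the invariance predicate handed to the generation theorem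
  have key := hGen
    (fun A : EuclideanSpace ℝ (Fin 4) ≃ₗᵢ[ℝ] EuclideanSpace ℝ (Fin 4) => LinearMap.det (A.toLinearEquiv : EuclideanSpace ℝ (Fin 4) →ₗ[ℝ] EuclideanSpace ℝ (Fin 4)) = 1 ∧
      ∀ (m : ℕ) (τ : Fin m → QCDField Nf) (G : 𝓢((Fin m → EuclideanSpace ℝ (Fin 4)), ℂ)),
        IsOffDiagonal G → S m τ (linActMulti A G) = S m τ G)
    ?_ ?_ ?_ ?_ ?_ Rot hdet
  · exact key.2 n σ F hF
  · -- closed under composition (`linActMulti (A.trans B) = linActMulti B ∘ linActMulti A` by `rfl`)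
    rintro A B ⟨hA, hA'⟩ ⟨hB, hB'⟩
    refine ⟨by rw [det_trans, hA, hB, one_mul], fun m τ G hG => ?_⟩
    have htr : linActMulti (A.trans B) G = linActMulti B (linActMulti A G) := by
      ext x
      rfl
    rw [htr, hB' m τ _ (LatticeInvariancePassesToLimit.isOffDiagonal_linActMulti A hG), hA' m τ G hG]
  · -- closed under inverses
    rintro A ⟨hA, hA'⟩
    exact ⟨det_symm hA, invariant_symm S A hA'⟩
  · -- (H01) the coordinate `SO(2)₀₁`: tensor level (S2) lifted to `⁰𝒮` by totality (S3)
    intro A hA h2 h3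
    refine ⟨hA, fun m τ => ?_⟩
    exact hT m ((S m τ).comp (linActMulti A)) (S m τ)
      (fun f hf G hG => hP Nf sch hAF hbr hgap S hlim m τ A ⟨hA, h2, h3⟩ f hf G hG)
  · -- (H12) stabiliser of `(e₀, e₃)`: conjugate by the even permutation `(0 1 2)`
    intro A hA h0 h3
    refine ⟨hA, invariant_of_conj S (axisPerm (Equiv.swap (0 : Fin 4) 2 * Equiv.swap 0 1 : Equiv.Perm (Fin 4))) A (hperm _ sign_permA) fun m τ => ?_⟩
    have hC2 : (axisPerm (Equiv.swap (0 : Fin 4) 2 * Equiv.swap 0 1 : Equiv.Perm (Fin 4))).trans (A.trans (axisPerm (Equiv.swap (0 : Fin 4) 2 * Equiv.swap 0 1 : Equiv.Perm (Fin 4))).symm) (EuclideanSpace.single 2 1) =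
        EuclideanSpace.single 2 1 := by
      rw [LinearIsometryEquiv.trans_apply, LinearIsometryEquiv.trans_apply, axisPerm_single, permA_two,
        h0, axisPerm_symm_single, permA_symm_zero]
    have hC3 : (axisPerm (Equiv.swap (0 : Fin 4) 2 * Equiv.swap 0 1 : Equiv.Perm (Fin 4))).trans (A.trans (axisPerm (Equiv.swap (0 : Fin 4) 2 * Equiv.swap 0 1 : Equiv.Perm (Fin 4))).symm) (EuclideanSpace.single 3 1) =
        EuclideanSpace.single 3 1 := by
      rw [LinearIsometryEquiv.trans_apply, LinearIsometryEquiv.trans_apply, axisPerm_single, permA_three,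
        h3, axisPerm_symm_single, permA_symm_three]
    exact hT m ((S m τ).comp (linActMulti _)) (S m τ)
      (fun f hf G hG => hP Nf sch hAF hbr hgap S hlim m τ _ ⟨det_conj _ A hA, hC2, hC3⟩ f hf G hG)
  · -- (H23) stabiliser of `(e₀, e₁)`: conjugate by the even permutation `(0 2)(1 3)`
    intro A hA h0 h1
    refine ⟨hA, invariant_of_conj S (axisPerm (Equiv.swap (0 : Fin 4) 2 * Equiv.swap 1 3 : Equiv.Perm (Fin 4))) A (hperm _ sign_permB) fun m τ => ?_⟩
    have hC2 : (axisPerm (Equiv.swap (0 : Fin 4) 2 * Equiv.swap 1 3 : Equiv.Perm (Fin 4))).trans (A.trans (axisPerm (Equiv.swap (0 : Fin 4) 2 * Equiv.swap 1 3 : Equiv.Perm (Fin 4))).symm) (EuclideanSpace.single 2 1) =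
        EuclideanSpace.single 2 1 := by
      rw [LinearIsometryEquiv.trans_apply, LinearIsometryEquiv.trans_apply, axisPerm_single, permB_two,
        h0, axisPerm_symm_single, permB_symm_zero]
    have hC3 : (axisPerm (Equiv.swap (0 : Fin 4) 2 * Equiv.swap 1 3 : Equiv.Perm (Fin 4))).trans (A.trans (axisPerm (Equiv.swap (0 : Fin 4) 2 * Equiv.swap 1 3 : Equiv.Perm (Fin 4))).symm) (EuclideanSpace.single 3 1) =
        EuclideanSpace.single 3 1 := by
      rw [LinearIsometryEquiv.trans_apply, LinearIsometryEquiv.trans_apply, axisPerm_single, permB_three,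
        h1, axisPerm_symm_single, permB_symm_one]
    exact hT m ((S m τ).comp (linActMulti _)) (S m τ)
      (fun f hf G hG => hP Nf sch hAF hbr hgap S hlim m τ _ ⟨det_conj _ A hA, hC2, hC3⟩ f hf G hG)

/-- **`RotationRestoration` (the `GapBuysCauchyRate` copy) from planar Ward restoration alone** — the five
other stub statements are discharged by the landed theorems; CONDITIONAL on `PlanarWardOnSeparatedTensors`
(registered stub `stub_planarWardOnSeparatedTensors`, the crux's physics). -/
theorem RotationRestoration_of_planarWard (hP : PlanarWardOnSeparatedTensors) : RotationRestoration :=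
  RotationRestoration_of stub_latticePermCovariance stub_latticeInvariancePassesToLimit stub_evenPermSpinor hP
    stub_separatedTensorsTotal stub_so4FromCoordinatePlanes

/-- The same reduction for the PRIMARY copy `FourMirrorsWardE1.RotationRestoration` (definitionally equal). -/
theorem RotationRestoration_of_planarWard_primary (hP : PlanarWardOnSeparatedTensors) :
    Summit.QuantumFields.QCD.Theses.FourMirrorsWardE1.RotationRestoration :=
  RotationRestoration_of stub_latticePermCovariance stub_latticeInvariancePassesToLimit stub_evenPermSpinor hP
    stub_separatedTensorsTotal stub_so4FromCoordinatePlanes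

/-- The same reduction for the copy `DiagonalSpine.RotationRestoration` (definitionally equal). -/
theorem RotationRestoration_of_planarWard_diagonalSpine (hP : PlanarWardOnSeparatedTensors) :
    Summit.QuantumFields.QCD.Theses.DiagonalSpine.RotationRestoration :=
  RotationRestoration_of stub_latticePermCovariance stub_latticeInvariancePassesToLimit stub_evenPermSpinor hP
    stub_separatedTensorsTotal stub_so4FromCoordinatePlanes

end Summit.QuantumFields.QCD.Cruxes.RotationRestoration.Birth

end
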